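import Summits.QuantumFields.YangMills.Theorems.FlatTubeReductionCoreDefectPotCurrency
import Summits.QuantumFields.YangMills.Theorems.FlatTubeReductionCurrencyFloorR
import Summits.QuantumFields.YangMills.Theorems.FlatTubeReductionTailPieceK
import Summits.QuantumFields.YangMills.Theorems.FlatTubeReductionRecordSplitK
import Summits.QuantumFields.YangMills.Theorems.FlatTubeReductionShellPieceK
import Summits.QuantumFields.YangMills.Theorems.FlatTubeReductionOutPieceK
import Summits.QuantumFields.YangMills.Theorems.FlatTubeReductionHODPotDoorA
import Summits.QuantumFields.YangMills.Theorems.FlatTubeReductionStiffSepHsepK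
import Summits.QuantumFields.YangMills.Theorems.FlatTubeReductionPieceRatesSqK
import Summits.QuantumFields.YangMills.Theorems.FlatTubeReductionRecordSupportK
import Summits.QuantumFields.YangMills.Theorems.LuscherReductionTwistedTraceScalingBODefectHOD
import Summits.QuantumFields.YangMills.Theorems.LuscherReductionTwistedTraceScalingBODefectTailSchedule
import Summits.QuantumFields.YangMills.Theorems.FlatTubeReductionHODPotAlgebra
import HarnessLib

/-!
# (E4) `stub_hODpot_A` OF LINE "ratepack_v2" (crux K1 `NearFlatRatioLaw`, skeleton v6) MODULO THE CENTRAL QUASIMODE RATE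
# (explicit-unit seat `ym-line-ftr-p1` g19; memo `Cruxes/NearFlatRatioLaw/Lines/ratepack-v8-core-g19.md`)

★★★ `hODpot_A_of_quasimode` — for `L ≥ 2` and a central quasimode `(c₁, η)` of the core fibre transfer (the hypothesis `hquasi`, verbatim the input of
`…CoreDefectRecordOrbitMomentsQuasi` / `…CoreDefectPotCurrency.core_defect_pot_currency`) whose defect is AT RATE, `∃ a, ∀ᶠ β, η(β)² ≤ a·λ_b(L³β)²`, the body of the
registered stub `stub_hODpot_A` holds for this `L`: `∃ M₂ ∀ M ≥ M₂ ∃ b_A κ_A ≥ 0, b_A² = O(λ_b²)` and eventually the two (OD)-with-potential inequalities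
`|X(boFun φ Ω_β, v)|, |X(v, boFun φ Ω_β)| ≤ Λ_A(β)·√(b_A(β)²·T(boFun φ Ω_β) + κ_A·γ_β·∫𝟙_{orbitDist<Dδ₁}orbitDist²φ²)·√T(v)` for the record weight `recordChi L (1/6) (42D+1) M`,
`D = max 1 (|Λ|/7)`, `Λ_A = btC/fpZ/γ·λ₀`.  So the stub is reduced to ONE analytic input: the central quasimode at rate `β^{-1/3}` (lane A's
`central_quasimode_rate` gives only `η = β^{-1/5}`); the skeleton is reshaped accordingly (`stub_hODpot_A := hODpot_A_of_quasimode ∘ stub_C1rate`).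

Assembly (lane A `…BODefectHOD.hOD_record` + `…BODefectHODFixed.hdef_fixed`, ported to `s = 1/6`, cap constant `K_c = 42D+1`, the potential and the `λ_b²` rate):
`core_defect_pot_currency` (core piece, in currency, with potential) + `tail_sq_integral_le_K` + `out_sq_integral_le_of_sep_K` (with `hsep_record_K`) +
`shell_dualBO_sq_integral_le_K` against `currency_floor_R/_inv_R`, `btC_floor_of_quasimode_eta`, `tubeNormSq_record_ge_R`, `recordGamma_le_two_mul_inner`,
`exists_linkCE_le_two_mul_levelValue_zero`; split `record_defect_split_K`, defect `defect_of_weight_lower_bound`, door `hODpotA_of_defect`; rates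
`tail/out/shell_rate_small_sq_K` + `powScale (2/3) β = O(λ_b²)`.  §0 holds the scalar algebra, §1 small analytic helpers, §2 the theorem.
HONEST FRAMING: helper for stub_hODpot_A of crux K1 (OPEN: the quasimode rate remains); R2b1 is a RECORD rung; no summit statement is proved; the YM gap is NOT proved.
-/

set_option autoImplicit false

noncomputable section

open MeasureTheory Filter Topology Real
open scoped BigOperators
open Literature.MathematicalPhysics.QuantumFieldTheory
open Literature.MathematicalPhysics.QuantumLattice

namespace Summit.QuantumFields.YangMills.Theorems.FemtoTransferGap.TwoLattice.ConstTube

open Summit.QuantumFields.YangMills.Theorems.FemtoTransferGap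
open Summit.QuantumFields.YangMills.Theorems.FemtoTransferGap.TwoLattice
open Summit.QuantumFields.YangMills.Theorems.FemtoTransferGap.TwoLattice.Avg
open Summit.QuantumFields.YangMills.Theorems.FemtoTransferGap.TwoLattice.Stiff
open Summit.QuantumFields.YangMills.Theorems.FemtoTransferGap.TwoLattice.GnChart
open Summit.QuantumFields.YangMills.Theorems.FemtoTransferGap.TwoLattice.Cov
open Summit.QuantumFields.YangMills.Theorems.FemtoTransferGap.RateTube

variable {L : ℕ} [NeZero L]

/-! ## §2 The stub modulo the quasimode rate -/

set_option maxHeartbeats 8000000 in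
-- the assembly of ~20 eventual bricks with very large record expressions.
/-- ★★★ **`stub_hODpot_A` FOR `L ≥ 2` FROM A CENTRAL QUASIMODE AT RATE** (see the module docstring): the conclusion is VERBATIM the body of the registered stub
`Summit.QuantumFields.YangMills.Cruxes.NearFlatRatioLaw.RatePackV6.stub_hODpot_A` at `L`. [cite: Luscher1983, §3] [cite: SjostrandZworski2007, §2] -/
theorem hODpot_A_of_quasimode (hLz : Nonempty (NzSite L)) (hL2 : 2 ≤ L) {c₁ η : ℝ → ℝ}
    (hquasi : ∀ᶠ β : ℝ in atTop, 0 < c₁ β ∧ 0 ≤ η β ∧ ∀ v' : Edge 3 L → Fin 3 → ℝ, v' ∈ capBalancedSet L →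
      (∀ (e : Edge 3 L) (c : Fin 3), |v' e c| ≤ (9 * (L : ℝ) * (5 * (powScale (1 / 2) β * btLog β ^ 2)) + (powScale 1 β))) → ‖linkEmbed L v'‖ ≤ (min (1 / 40) (powScale (1 / 2) β * btLog β)) / 12 →
      |fpFibreTransfer L β (fun x : LinkSpace L => {x : LinkSpace L | linkCurry x ∈ capBalancedSet L}.indicator (fun _ => (1 : ℝ)) x * frozenProfile L (fun β' => stiffGaussExp L (β' / 2) β') (fun β' => min (1 / 40) (powScale (1 / 2) β' * btLog β')) β x) (coreWeight L (powScale 1 β) (5 * (powScale (1 / 2) β * btLog β ^ 2))) (orthoTube L 1 v') 1 - c₁ β * ((stiffGaussTop L (β / 2) β * Real.exp (-stiffGaussExp L (β / 2) β (linkEmbed L v'))) / (∫ u, ({u : GaugeConfig 3 1 SU2 | (∀ k : Fin 3, ‖su2Quat (u (0, k)) - 1‖ ≤ (powScale (1 / 3) β)) ∧ (L : ℝ) ^ 3 * wilsonAction su2Rep u ≤ (powScale (1 / 2) β)}.indicator (fun _ => (1 : ℝ))) u * (transferKernel su2Rep ((L : ℝ) ^ 3 * β) (1 : GaugeConfig 3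 1 SU2) u / transferKernel su2Rep ((L : ℝ) ^ 3 * β) (1 : GaugeConfig 3 1 SU2) 1) ∂configMeasure SU2 1))| ≤ η β * (c₁ β * ((stiffGaussTop L (β / 2) β * Real.exp (-stiffGaussExp L (β / 2) β (linkEmbed L v'))) / (∫ u, ({u : GaugeConfig 3 1 SU2 | (∀ k : Fin 3, ‖su2Quat (u (0, k)) - 1‖ ≤ (powScale (1 / 3) β)) ∧ (L : ℝ) ^ 3 * wilsonAction su2Rep u ≤ (powScale (1 / 2) β)}.indicator (fun _ => (1 : ℝ))) u * (transferKernel su2Rep ((L : ℝ) ^ 3 * β) (1 : GaugeConfig 3 1 SU2) u / transferKernel su2Rep ((L : ℝ) ^ 3 * β) (1 : GaugeConfig 3 1 SU2) 1) ∂configMeasure SU2 1))))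
    (hηrate : ∃ a : ℝ, ∀ᶠ β : ℝ in atTop, η β ^ 2 ≤ a * bareLambda ((L : ℝ) ^ 3 * β) ^ 2) :
    ∃ M₂ : ℝ, ∀ M : ℝ, M₂ ≤ M → ∃ (bA : ℝ → ℝ) (κA : ℝ), 0 ≤ κA ∧ (∀ β, 0 ≤ bA β) ∧ (∃ a : ℝ, ∀ᶠ β : ℝ in atTop, bA β ^ 2 ≤ a * bareLambda ((L : ℝ) ^ 3 * β) ^ 2) ∧ ∀ᶠ β : ℝ in atTop, ∀ (φ : GaugeConfig 3 1 SU2 → ℝ) (v : GaugeConfig 3 L SU2 → ℝ), Measurable φ → (∃ C : ℝ, ∀ u, |φ u| ≤ C) → (∀ (g : Site 3 1 → SU2) (u : GaugeConfig 3 1 SU2), φ (gaugeTransform g u) = φ u) → (∀ u, φ u ≠ 0 → orbitDist u < max 1 ((Fintype.card (Site 3 L) : ℝ) / 7) * recordDelta1 L (1 / 6) β) → Measurable v → (∃ C : ℝ, ∀ U, |v U| ≤ C) → (∀ U, v U ≠ 0 → recordChi L (1 / 6) (42 * max 1 ((Fintype.card (Site 3 L) : ℝ) / 7) + 1) M β U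 ≠ 0) → (∀ u, fibreInner L (softWeight (recordChi L (1 / 6) (42 * max 1 ((Fintype.card (Site 3 L) : ℝ) / 7) + 1) M β)) (recordProfile L β) v u = 0) → |tubeCross β (boFun L φ (recordProfile L β)) v| ≤ (btC L β (recordProfile L β) (btEps β) (5 * (powScale (1 / 2) β * btLog β ^ 2)) / fpZ (btEps β) / recordGamma L (recordProfile L) β * levelValue su2Rep 1 ((L : ℝ) ^ 3 * β) 0) * Real.sqrt (bA β ^ 2 * tubeNormSq (softWeight (recordChi L (1 / 6) (42 * max 1 ((Fintype.card (Site 3 L) : ℝ) / 7) + 1) M β)) (boFun L φ (recordProfile L β)) + κA * recordGamma L (recordProfile L) β * ∫ u, (if orbitDist u < max 1 ((Fintype.card (Site 3 L) : ℝ) / 7) * recordDelta1 L (1 / 6) β then orbitDist u ^ 2 else 0) * φ u ^ 2 ∂configMeasure SU2 1) * Real.sqrt (tubeNormSq (softWeight (recordChi L (1 / 6) (42 * max 1 ((Fintype.card (Site 3 L) : ℝ) / 7) + 1) M β)) v) ∧ |tubeCross β v (boFun L φ (recordProfile L β))| ≤ (btC L β (recordProfile L β) (btEps β) (5 * (powScale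 (1 / 2) β * btLog β ^ 2)) / fpZ (btEps β) / recordGamma L (recordProfile L) β * levelValue su2Rep 1 ((L : ℝ) ^ 3 * β) 0) * Real.sqrt (bA β ^ 2 * tubeNormSq (softWeight (recordChi L (1 / 6) (42 * max 1 ((Fintype.card (Site 3 L) : ℝ) / 7) + 1) M β)) (boFun L φ (recordProfile L β)) + κA * recordGamma L (recordProfile L) β * ∫ u, (if orbitDist u < max 1 ((Fintype.card (Site 3 L) : ℝ) / 7) * recordDelta1 L (1 / 6) β then orbitDist u ^ 2 else 0) * φ u ^ 2 ∂configMeasure SU2 1) * Real.sqrt (tubeNormSq (softWeight (recordChi L (1 / 6) (42 * max 1 ((Fintype.card (Site 3 L) : ℝ) / 7) + 1) M β)) v) := by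
  have hs0 : (0 : ℝ) < 1 / 6 := by norm_num
  have hs2 : (1 / 6 : ℝ) < 1 / 2 := by norm_num
  have hs3 : (1 / 6 : ℝ) ≤ 1 / 3 := by norm_num
  have hN : (0 : ℝ) < (Fintype.card (Site 3 L) : ℝ) := card_site_pos (L := L)
  have hN1 : (1 : ℝ) ≤ (Fintype.card (Site 3 L) : ℝ) := by exact_mod_cast Fintype.card_pos
  have hL1 : (1 : ℝ) ≤ L := by exact_mod_cast NeZero.one_le
  have hL3 : (1 : ℝ) ≤ (L : ℝ) ^ 3 := one_le_pow₀ hL1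
  -- the window constant `D = max 1 (|Λ|/7)` and the cap constant `K_c = 42D+1`
  have hD1 : (1 : ℝ) ≤ max 1 ((Fintype.card (Site 3 L) : ℝ) / 7) := le_max_left _ _
  have hD0 : (0 : ℝ) ≤ max 1 ((Fintype.card (Site 3 L) : ℝ) / 7) := le_trans zero_le_one hD1
  have hDΛ : max 1 ((Fintype.card (Site 3 L) : ℝ) / 7) ≤ Fintype.card (Site 3 L) := max_le hN1 (by linarith)
  have hKc : (1 : ℝ) ≤ (42 * max 1 ((Fintype.card (Site 3 L) : ℝ) / 7) + 1) := by linarith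
  have hKc0 : (0 : ℝ) < (42 * max 1 ((Fintype.card (Site 3 L) : ℝ) / 7) + 1) := by linarith
  have hDK : 14 * max 1 ((Fintype.card (Site 3 L) : ℝ) / 7) / Fintype.card (Site 3 L) ≤ (42 * max 1 ((Fintype.card (Site 3 L) : ℝ) / 7) + 1) := by
    rw [div_le_iff₀ hN]; nlinarith
  have hDO0 : (0 : ℝ) ≤ ((12 * (42 * max 1 ((Fintype.card (Site 3 L) : ℝ) / 7) + 1) + 1) / (Fintype.card (Site 3 L) : ℝ)) := by positivity
  have hD14 : 14 / Fintype.card (Site 3 L) ≤ ((12 * (42 * max 1 ((Fintype.card (Site 3 L) : ℝ) / 7) + 1) + 1) / (Fintype.card (Site 3 L) : ℝ)) := div_le_div_of_nonneg_right (by nlinarith) hN.le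
  have hη0e : ∀ᶠ β : ℝ in atTop, 0 ≤ η β := hquasi.mono fun β h => h.2.1
  have hηs : ∀ᶠ β : ℝ in atTop, η β ≤ 1 / 2 := eta_le_half_of_rate (L := L) hη0e hηrate
  -- the constants of the bricks
  obtain ⟨M₁, hM₁, hcoreM⟩ := core_defect_pot_currency (L := L) hLz hL2 hD0 hDΛ hquasi hηs
  obtain ⟨M₂, hM₂, hnormM⟩ := tubeNormSq_record_ge_R (L := L) hLz hD0
  obtain ⟨M₃, hM₃, hflM⟩ := currency_floor_R (L := L) hLz hD0
  obtain ⟨M₄, hM₄, hfliM⟩ := currency_floor_inv_R (L := L) hLz hD0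
  have hδ0 : ∀ β, 0 < (fun β : ℝ => (42 * max 1 ((Fintype.card (Site 3 L) : ℝ) / 7) + 1) * powScale (1 / 6) β) β := fun β => mul_pos hKc0 (powScale_pos _ _)
  have hδt : Tendsto (fun β : ℝ => (42 * max 1 ((Fintype.card (Site 3 L) : ℝ) / 7) + 1) * powScale (1 / 6) β) atTop (𝓝 0) := by
    simpa using (tendsto_powScale (σ := 1 / 6) hs0).const_mul ((42 * max 1 ((Fintype.card (Site 3 L) : ℝ) / 7) + 1))
  have hsd : ∀ᶠ β in atTop, 0 < powScale 1 β ∧ powScale 1 β ≤ (fun β : ℝ => (42 * max 1 ((Fintype.card (Site 3 L) : ℝ) / 7) + 1) * powScale (1 / 6) β) β ^ 3 := by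
    filter_upwards [eventually_ge_atTop (1 : ℝ)] with β hβ
    refine ⟨powScale_pos _ _, ?_⟩
    have h1 : powScale 1 β ≤ powScale (1 / 6) β ^ 3 := powScale_one_le_cube hs3 hβ
    have h2 : powScale (1 / 6) β ^ 3 ≤ ((42 * max 1 ((Fintype.card (Site 3 L) : ℝ) / 7) + 1) * powScale (1 / 6) β) ^ 3 :=
      pow_le_pow_left₀ (powScale_pos _ _).le (le_mul_of_one_le_left (powScale_pos _ _).le hKc) 3
    exact h1.trans h2
  obtain ⟨M₅, hM₅, hPM⟩ := fpWeight_core_constant L hLz hδ0 hδt hsd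
  refine ⟨max (max (max M₁ M₂) (max M₃ M₄)) M₅, fun M hM => ?_⟩
  have hMM1 : M₁ ≤ M := le_trans (le_trans (le_max_left _ _) (le_max_left _ _)) (le_trans (le_max_left _ _) hM)
  have hMM2 : M₂ ≤ M := le_trans (le_trans (le_max_right _ _) (le_max_left _ _)) (le_trans (le_max_left _ _) hM)
  have hMM3 : M₃ ≤ M := le_trans (le_trans (le_max_left _ _) (le_max_right _ _)) (le_trans (le_max_left _ _) hM)
  have hMM4 : M₄ ≤ M := le_trans (le_trans (le_max_right _ _) (le_max_right _ _)) (le_trans (le_max_left _ _) hM)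
  have hMM5 : M₅ ≤ M := le_trans (le_max_right _ _) hM
  have hM0 : 0 ≤ M := by linarith
  obtain ⟨Cb, κA, hCb0, hκA0, hcoreE⟩ := hcoreM M hMM1 ((12 * (42 * max 1 ((Fintype.card (Site 3 L) : ℝ) / 7) + 1) + 1) / (Fintype.card (Site 3 L) : ℝ)) hDO0
  have hnormE := hnormM M hMM2
  obtain ⟨cR, K, hcR, hflE⟩ := hflM M hMM3
  obtain ⟨cR', K', hcR', hfliE⟩ := hfliM M hMM4
  obtain ⟨Cw, β₀, hCw, hPF⟩ := hPM M hMM5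
  obtain ⟨q₀, hq₀, htailE⟩ := eventually_tail_schedule (L := L) (s := 1 / 6) hs0 hs2 (Dδ := ((12 * (42 * max 1 ((Fintype.card (Site 3 L) : ℝ) / 7) + 1) + 1) / (Fintype.card (Site 3 L) : ℝ))) hD14
  obtain ⟨B₀, hB₀, hCE⟩ := PolyakovLift.exists_linkCE_le_two_mul_levelValue_zero
  obtain ⟨Cbt, Kb, hCbt, hbtCfl⟩ := btC_record_poly_floor (L := L)
  obtain ⟨aη, hηr⟩ := hηrate
  obtain ⟨Cps, hCps, hps23⟩ := powScale_two_thirds_le_bareLambda_sq (L := L)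
  refine ⟨fun β => Real.sqrt (2 * (Cb * (η β ^ 2 + powScale (2 / 3) β) + ((Real.exp (β * (2 * (Fintype.card (Edge 3 L) : ℝ))) * (Real.exp (-(β * btMnt L (((12 * (42 * max 1 ((Fintype.card (Site 3 L) : ℝ) / 7) + 1) + 1) / (Fintype.card (Site 3 L) : ℝ)) * powScale (1 / 6) β) (powScale (1 / 2) β * btLog β ^ 2) (min (1 / 40) (powScale (1 / 2) β * btLog β)) (5 * (powScale (1 / 2) β * btLog β ^ 2)) (powScale 1 β))) + Real.exp (-(β * btMfar L (((12 * (42 * max 1 ((Fintype.card (Site 3 L) : ℝ) / 7) + 1) + 1) / (Fintype.card (Site 3 L) : ℝ)) * powScale (1 / 6) β) (powScale (1 / 2) β * btLog β ^ 2) (min (1 / 40) (powScale (1 / 2) β * btLog β)) (powScale 1 β) (13 * (((12 * (42 * max 1 ((Fintype.card (Site 3 L) : ℝ) / 7) + 1) + 1) / (Fintype.card (Site 3 L) : ℝ)) * powScale (1 / 6) β))))) * ∫ v, (fun x : LinkSpace L => {x : LinkSpace L | linkCurry x ∈ capBalancedSet L}.indicator (fun _ => (1 : ℝ)) x * frozenProfile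 L (fun β' => stiffGaussExp L (β' / 2) β') (fun β' => min (1 / 40) (powScale (1 / 2) β' * btLog β')) β x) (linkEmbed L v) ∂orthoTransverse L) ^ 2 * (1 / (fpWeightBar L (powScale 1 β) * (1 - Cw * ((42 * max 1 ((Fintype.card (Site 3 L) : ℝ) / 7) + 1) * powScale (1 / 6) β) ^ 2)))) / (cR' * powScale 1 β ^ K' * (Real.exp (2 * β) ^ Fintype.card (Edge 3 L)) ^ 2) + (3 * ((orthoTransverse L Set.univ).toReal * (1 / (fpWeightBar L (powScale 1 β) * (1 - Cw * ((42 * max 1 ((Fintype.card (Site 3 L) : ℝ) / 7) + 1) * powScale (1 / 6) β) ^ 2))) * ((Real.exp (2 * β) ^ Fintype.card (Edge 3 L)) ^ 2 * (Real.exp (-(β * (2 - 2 * Real.cos (2 * Real.pi / L)) * ((min (1 / 40) (powScale (1 / 2) β * btLog β)) / 12 / 2) ^ 2)) + Real.exp (-(((powScale 1 β) * btLog β) ^ 2 / powScale 1 β ^ 2)) ^ 2 + Real.exp (-(((powScale 1 β) * btLog β) ^ 2 / powScale 1 β ^ 2))) + Real.exp (2 * β) ^ Fintype.card (Edge 3 L)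 * (Real.exp (2 * β) ^ Fintype.card (Edge 3 L) * Real.exp (-(β * ((min (1 / 40) (powScale (1 / 2) β * btLog β)) / 1000) ^ 2)))))) / (cR * powScale 1 β ^ K * (Real.exp (2 * β) ^ Fintype.card (Edge 3 L)) ^ 2) + 8 * (8 * (fpWeightBar L (powScale 1 β) * (1 + Cw * ((42 * max 1 ((Fintype.card (Site 3 L) : ℝ) / 7) + 1) * powScale (1 / 6) β) ^ 2)) * (Real.exp (-(β * (2 - 2 * Real.cos (2 * Real.pi / L)) * ((min (1 / 40) (powScale (1 / 2) β * btLog β)) / 12) ^ 2)) * (orthoTransverse L Set.univ).toReal) / ((1 - powScale (1 / 5) β) ^ 2 * (1 - 0 * ((42 * max 1 ((Fintype.card (Site 3 L) : ℝ) / 7) + 1) * powScale (1 / 6) β) ^ 2) * (∫ v, {v : Edge 3 L → Fin 3 → ℝ | ‖linkEmbed L v‖ ≤ (min (1 / 40) (powScale (1 / 2) β * btLog β)) / 12}.indicator (fun _ => (1 : ℝ)) v * (Real.exp (-(stiffGaussExp L (β / 2) β (linkEmbed L v))) ^ 2 * Real.exp (-(‖(gaugeModes L).starProjection (linkEmbed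 L v)‖ ^ 2 / powScale 1 β ^ 2))) ∂orthoTransverse L) * fpWeightBar L (powScale 1 β))))), 2 * κA, by positivity, fun β => Real.sqrt_nonneg _, ?_, ?_⟩
  · -- `b_A² = 2(C_b(η² + β^{-2/3}) + r_T + r_O + 8 r_B) = O(λ_b²)`
    have htail2 : ∀ᶠ β : ℝ in atTop, Real.log β ^ 4 / 4 ≤ β * btMnt L (((12 * (42 * max 1 ((Fintype.card (Site 3 L) : ℝ) / 7) + 1) + 1) / (Fintype.card (Site 3 L) : ℝ)) * powScale (1 / 6) β) (powScale (1 / 2) β * btLog β ^ 2) (min (1 / 40) (powScale (1 / 2) β * btLog β)) (5 * (powScale (1 / 2) β * btLog β ^ 2)) (powScale 1 β) ∧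
        q₀ * Real.log β ^ 4 ≤ β * btMfar L (((12 * (42 * max 1 ((Fintype.card (Site 3 L) : ℝ) / 7) + 1) + 1) / (Fintype.card (Site 3 L) : ℝ)) * powScale (1 / 6) β) (powScale (1 / 2) β * btLog β ^ 2) (min (1 / 40) (powScale (1 / 2) β * btLog β)) (powScale 1 β) (13 * (((12 * (42 * max 1 ((Fintype.card (Site 3 L) : ℝ) / 7) + 1) + 1) / (Fintype.card (Site 3 L) : ℝ)) * powScale (1 / 6) β)) := by
      filter_upwards [htailE] with β h; exact ⟨h.2.2.2.2.2.2.1, h.2.2.2.2.2.2.2⟩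
    have h2r := tail_rate_small_sq_K (L := L) hs0 ((42 * max 1 ((Fintype.card (Site 3 L) : ℝ) / 7) + 1)) Cw (((12 * (42 * max 1 ((Fintype.card (Site 3 L) : ℝ) / 7) + 1) + 1) / (Fintype.card (Site 3 L) : ℝ))) hq₀ hcR' K' htail2
    have h3r := out_rate_small_sq_K (L := L) hL2 hs0 ((42 * max 1 ((Fintype.card (Site 3 L) : ℝ) / 7) + 1)) Cw hcR K
    have h4r := shell_rate_small_sq_K (L := L) hL2 hs0 ((42 * max 1 ((Fintype.card (Site 3 L) : ℝ) / 7) + 1)) Cw 0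
    refine ⟨2 * (Cb * (max aη 0 + Cps) + 3), ?_⟩
    filter_upwards [hηr, hps23, h2r 1 one_pos, h3r 1 one_pos, h4r (1 / 8) (by norm_num), hη0e] with β hη hps h2 h3 h4 hη0
    have hl2 : 0 ≤ bareLambda ((L : ℝ) ^ 3 * β) ^ 2 := sq_nonneg _
    refine sqrt_sq_le_of_le ?_ (by positivity)
    have hA : Cb * (η β ^ 2 + powScale (2 / 3) β) ≤ Cb * ((max aη 0 + Cps) * bareLambda ((L : ℝ) ^ 3 * β) ^ 2) := by
      refine mul_le_mul_of_nonneg_left ?_ hCb0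
      have h1 : η β ^ 2 ≤ max aη 0 * bareLambda ((L : ℝ) ^ 3 * β) ^ 2 := hη.trans (mul_le_mul_of_nonneg_right (le_max_left _ _) hl2)
      nlinarith [h1, hps]
    nlinarith [hA, h2, h3, h4, hl2, hCb0, le_max_right aη 0, hCps.le]
  · -- the (OD)-with-potential clause via the door `hODpotA_of_defect`
    have hΩm' : ∀ β, Measurable ((fun β => recordProfile L β) β) := fun β => (recordProfile_fields (L := L)).1 β
    have hΩ1' : ∀ β x, |(fun β => recordProfile L β) β x| ≤ 1 := fun β x => (recordProfile_fields (L := L)).2.2.1 β x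
    have hw : ∀ β, Measurable (softWeight ((fun β => (recordChi L (1 / 6) (42 * max 1 ((Fintype.card (Site 3 L) : ℝ) / 7) + 1) M β)) β)) ∧ (∃ C : ℝ, ∀ U, |softWeight ((fun β => (recordChi L (1 / 6) (42 * max 1 ((Fintype.card (Site 3 L) : ℝ) / 7) + 1) M β)) β) U| ≤ C) ∧ ∀ U, 0 ≤ softWeight ((fun β => (recordChi L (1 / 6) (42 * max 1 ((Fintype.card (Site 3 L) : ℝ) / 7) + 1) M β)) β) U :=
      fun β => by
        obtain ⟨hwm, hwb, hw0, -⟩ := softWeight_recordChi_props (L := L) (1 / 6) ((42 * max 1 ((Fintype.card (Site 3 L) : ℝ) / 7) + 1)) M β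
        exact ⟨hwm, ⟨_, hwb⟩, hw0⟩
    have hΛ : ∀ᶠ β in atTop, 0 ≤ (fun β => (btC L β (recordProfile L β) (btEps β) (5 * (powScale (1 / 2) β * btLog β ^ 2)) / fpZ (btEps β) / recordGamma L (recordProfile L) β * levelValue su2Rep 1 ((L : ℝ) ^ 3 * β) 0)) β := by
      filter_upwards [hbtCfl, eventually_ge_atTop (1 : ℝ), eventually_ge_atTop (2 / rStar ^ 3)] with β hbtC hβ1 hβr
      have hβ0 : 0 ≤ β := by linarith
      have hbt : 0 ≤ btC L β (recordProfile L β) (btEps β) (5 * (powScale (1 / 2) β * btLog β ^ 2)) :=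
        le_trans (mul_nonneg hCbt.le (pow_nonneg (powScale_pos 1 β).le _)) hbtC
      have hB0 : 0 ≤ (L : ℝ) ^ 3 * β := mul_nonneg (by positivity) hβ0
      have hB1 : 1 ≤ (L : ℝ) ^ 3 * β := by nlinarith
      have hr0 : 0 ≤ 2 / rStar ^ 3 := by have := rStar_pos; positivity
      have hB2 : 2 / rStar ^ 3 ≤ (L : ℝ) ^ 3 * β := by nlinarith
      have hlam : 0 ≤ levelValue su2Rep 1 ((L : ℝ) ^ 3 * β) 0 := le_trans
        (mul_nonneg (Real.exp_pos _).le (div_nonneg (mul_nonneg (Real.exp_pos _).le (Real.rpow_nonneg hB0 _)) (by norm_num)))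
        (levelValue_one_site_zero_ge hB1 hB2)
      have hγ : 0 < recordGamma L (recordProfile L) β := recordGamma_record_pos (L := L) hβ0
      exact mul_nonneg (div_nonneg (div_nonneg hbt (fpZ_pos (powScale_pos 1 β)).le) hγ.le) hlam
    have hKW : ∀ᶠ β : ℝ in atTop, Cw * ((42 * max 1 ((Fintype.card (Site 3 L) : ℝ) / 7) + 1) * powScale (1 / 6) β) ^ 2 ≤ 1 / 2 := by
      have h := ((tendsto_powScale hs0).const_mul ((42 * max 1 ((Fintype.card (Site 3 L) : ℝ) / 7) + 1))).pow 2 |>.const_mul Cw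
      rw [mul_zero, zero_pow two_ne_zero, mul_zero] at h
      exact h.eventually (eventually_le_nhds (by norm_num))
    have hp1e : ∀ᶠ β : ℝ in atTop, powScale (1 / 5) β < 1 := by
      filter_upwards [eventually_ge_atTop (2 : ℝ)] with β hβ2
      rw [powScale_eq (by linarith)]
      exact Real.rpow_lt_one_of_one_lt_of_neg (by linarith) (by norm_num)
    have hdef : ∀ᶠ β : ℝ in atTop, ∀ φ : GaugeConfig 3 1 SU2 → ℝ, Measurable φ → (∃ C : ℝ, ∀ u, |φ u| ≤ C) → (∀ (g : Site 3 1 → SU2) (u : GaugeConfig 3 1 SU2), φ (gaugeTransform g u) = φ u) → (∀ u, φ u ≠ 0 → orbitDist u < max 1 ((Fintype.card (Site 3 L) : ℝ) / 7) * recordDelta1 L (1 / 6) β) → ∃ (ψ : GaugeConfig 3 1 SU2 → ℝ) (E : GaugeConfig 3 L SU2 → ℝ), Measurable ψ ∧ (∃ C : ℝ, ∀ u, |ψ u| ≤ C) ∧ Measurable E ∧ (∃ C : ℝ, ∀ U, |E U| ≤ C) ∧ (∀ U, (recordChi L (1 / 6) (42 * max 1 ((Fintype.card (Site 3 L) : ℝ)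 / 7) + 1) M β) U ≠ 0 → ∫ V, avgKernel β U V * boFun L φ (recordProfile L β) V ∂configMeasure SU2 L = (boFun L ψ (recordProfile L β) U + E U) * softWeight (recordChi L (1 / 6) (42 * max 1 ((Fintype.card (Site 3 L) : ℝ) / 7) + 1) M β) U) ∧ ∫ U, E U ^ 2 * softWeight (recordChi L (1 / 6) (42 * max 1 ((Fintype.card (Site 3 L) : ℝ) / 7) + 1) M β) U ∂configMeasure SU2 L ≤ (btC L β (recordProfile L β) (btEps β) (5 * (powScale (1 / 2) β * btLog β ^ 2)) / fpZ (btEps β) / recordGamma L (recordProfile L) β * levelValue su2Rep 1 ((L : ℝ) ^ 3 * β) 0) ^ 2 * ((Real.sqrt (2 * (Cb * (η β ^ 2 + powScale (2 / 3) β) + ((Real.exp (β * (2 * (Fintype.card (Edge 3 L) : ℝ))) * (Real.exp (-(β * btMnt L (((12 * (42 * max 1 ((Fintype.card (Site 3 L) : ℝ) / 7) + 1) + 1) / (Fintype.card (Site 3 L) : ℝ)) * powScale (1 / 6) β) (powScale (1 / 2) β * btLog β ^ 2) (min (1 / 40) (powScale (1 / 2) β * btLog β)) (5 * (powScale (1 /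 2) β * btLog β ^ 2)) (powScale 1 β))) + Real.exp (-(β * btMfar L (((12 * (42 * max 1 ((Fintype.card (Site 3 L) : ℝ) / 7) + 1) + 1) / (Fintype.card (Site 3 L) : ℝ)) * powScale (1 / 6) β) (powScale (1 / 2) β * btLog β ^ 2) (min (1 / 40) (powScale (1 / 2) β * btLog β)) (powScale 1 β) (13 * (((12 * (42 * max 1 ((Fintype.card (Site 3 L) : ℝ) / 7) + 1) + 1) / (Fintype.card (Site 3 L) : ℝ)) * powScale (1 / 6) β))))) * ∫ v, (fun x : LinkSpace L => {x : LinkSpace L | linkCurry x ∈ capBalancedSet L}.indicator (fun _ => (1 : ℝ)) x * frozenProfile L (fun β' => stiffGaussExp L (β' / 2) β') (fun β' => min (1 / 40) (powScale (1 / 2) β' * btLog β')) β x) (linkEmbed L v) ∂orthoTransverse L) ^ 2 * (1 / (fpWeightBar L (powScale 1 β) * (1 - Cw * ((42 * max 1 ((Fintype.card (Site 3 L) : ℝ) / 7) + 1) * powScale (1 / 6) β) ^ 2)))) / (cR' * powScale 1 β ^ K' * (Real.exp (2 * β) ^ Fintype.card (Edge 3 L)) ^ 2) + (3 * ((orthoTransverse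 L Set.univ).toReal * (1 / (fpWeightBar L (powScale 1 β) * (1 - Cw * ((42 * max 1 ((Fintype.card (Site 3 L) : ℝ) / 7) + 1) * powScale (1 / 6) β) ^ 2))) * ((Real.exp (2 * β) ^ Fintype.card (Edge 3 L)) ^ 2 * (Real.exp (-(β * (2 - 2 * Real.cos (2 * Real.pi / L)) * ((min (1 / 40) (powScale (1 / 2) β * btLog β)) / 12 / 2) ^ 2)) + Real.exp (-(((powScale 1 β) * btLog β) ^ 2 / powScale 1 β ^ 2)) ^ 2 + Real.exp (-(((powScale 1 β) * btLog β) ^ 2 / powScale 1 β ^ 2))) + Real.exp (2 * β) ^ Fintype.card (Edge 3 L) * (Real.exp (2 * β) ^ Fintype.card (Edge 3 L) * Real.exp (-(β * ((min (1 / 40) (powScale (1 / 2) β * btLog β)) / 1000) ^ 2)))))) / (cR * powScale 1 β ^ K * (Real.exp (2 * β) ^ Fintype.card (Edge 3 L)) ^ 2) + 8 * (8 * (fpWeightBar L (powScale 1 β) * (1 + Cw * ((42 * max 1 ((Fintype.card (Site 3 L) : ℝ) / 7) + 1) * powScale (1 / 6) β) ^ 2)) * (Real.exp (-(β * (2 -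 2 * Real.cos (2 * Real.pi / L)) * ((min (1 / 40) (powScale (1 / 2) β * btLog β)) / 12) ^ 2)) * (orthoTransverse L Set.univ).toReal) / ((1 - powScale (1 / 5) β) ^ 2 * (1 - 0 * ((42 * max 1 ((Fintype.card (Site 3 L) : ℝ) / 7) + 1) * powScale (1 / 6) β) ^ 2) * (∫ v, {v : Edge 3 L → Fin 3 → ℝ | ‖linkEmbed L v‖ ≤ (min (1 / 40) (powScale (1 / 2) β * btLog β)) / 12}.indicator (fun _ => (1 : ℝ)) v * (Real.exp (-(stiffGaussExp L (β / 2) β (linkEmbed L v))) ^ 2 * Real.exp (-(‖(gaugeModes L).starProjection (linkEmbed L v)‖ ^ 2 / powScale 1 β ^ 2))) ∂orthoTransverse L) * fpWeightBar L (powScale 1 β)))))) ^ 2 * tubeNormSq (softWeight (recordChi L (1 / 6) (42 * max 1 ((Fintype.card (Site 3 L) : ℝ) / 7) + 1) M β)) (boFun L φ (recordProfile L β)) + 2 * κA * recordGamma L (recordProfile L) β * ∫ u, (if orbitDist u < max 1 ((Fintype.card (Site 3 L) : ℝ) / 7) * recordDelta1 L (1 / 6) β then orbitDist u ^ 2 else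 0) * φ u ^ 2 ∂configMeasure SU2 1) := by
      filter_upwards [hcoreE, hnormE, hflE, hfliE, htailE, hsep_record_K (L := L) hD0 hKc hDK hM0, recordChi_support_K (L := L) hs0 hKc hM0,
        recordGamma_le_two_mul_inner (L := L) hL2, inner_mass_poly_floor (L := L), eventually_ge_atTop (max β₀ 2),
        eventually_ge_atTop (2 - 2 * Real.cos (2 * Real.pi / L)), eventually_ge_atTop B₀, hKW, hquasi, hηs, hp1e]
        with β hco hnormβ hflβ hfliβ hta hsepβ hsuppβ hγ2β hM2β hβmax hβg hβB hKWβ hq hηβ hp1 φ hφm hφb _hφinv hφs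
      obtain ⟨hc₁, -, hfloorβ⟩ := hq
      obtain ⟨hLa, hm₁, hm₂, hP3, hP0, hJ, -, -⟩ := hta
      have hβ2 : 2 ≤ β := le_trans (le_max_right _ _) hβmax
      have hβ1 : 1 ≤ β := by linarith
      have hβ0 : 0 < β := by linarith
      have hβ₀ : β₀ ≤ β := le_trans (le_max_left _ _) hβmax
      have hPFβ := hPF β hβ₀
      have hPlo : ∀ U ∈ fatTubeRho L (fun β => (42 * max 1 ((Fintype.card (Site 3 L) : ℝ) / 7) + 1) * powScale (1 / 6) β) (fun b => M * ((42 * max 1 ((Fintype.card (Site 3 L) : ℝ) / 7) + 1) * powScale (1 / 6) b)) β, fpWeightBar L (powScale 1 β) * (1 - Cw * ((42 * max 1 ((Fintype.card (Site 3 L) : ℝ) / 7) + 1) * powScale (1 / 6) β) ^ 2) ≤ gaugeAvg (recordChi L (1 / 6) (42 * max 1 ((Fintype.card (Site 3 L) : ℝ) / 7) + 1) M β) U :=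
        fun U hU => (hPFβ U hU).1
      have hPhi : ∀ U ∈ fatTubeRho L (fun β => (42 * max 1 ((Fintype.card (Site 3 L) : ℝ) / 7) + 1) * powScale (1 / 6) β) (fun b => M * ((42 * max 1 ((Fintype.card (Site 3 L) : ℝ) / 7) + 1) * powScale (1 / 6) b)) β, gaugeAvg (recordChi L (1 / 6) (42 * max 1 ((Fintype.card (Site 3 L) : ℝ) / 7) + 1) M β) U ≤ fpWeightBar L (powScale 1 β) * (1 + Cw * ((42 * max 1 ((Fintype.card (Site 3 L) : ℝ) / 7) + 1) * powScale (1 / 6) β) ^ 2) :=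
        fun U hU => (hPFβ U hU).2
      have hNb : 0 < fpWeightBar L (powScale 1 β) := fpWeightBar_pos L (powScale_pos 1 β)
      have hKW1 : 0 < 1 - Cw * ((42 * max 1 ((Fintype.card (Site 3 L) : ℝ) / 7) + 1) * powScale (1 / 6) β) ^ 2 := by linarith
      have hNκ : 0 < fpWeightBar L (powScale 1 β) * (1 - Cw * ((42 * max 1 ((Fintype.card (Site 3 L) : ℝ) / 7) + 1) * powScale (1 / 6) β) ^ 2) := mul_pos hNb hKW1
      have hNhi : 0 ≤ fpWeightBar L (powScale 1 β) * (1 + Cw * ((42 * max 1 ((Fintype.card (Site 3 L) : ℝ) / 7) + 1) * powScale (1 / 6) β) ^ 2) := by positivity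
      have hwS := softWeight_recordChi_ge_K (L := L) hNκ hPlo
      have hM2 := lt_of_lt_of_le (mul_pos (mul_pos (Real.exp_pos _) (pow_pos (by positivity) _)) (pow_pos (powScale_pos 1 β) _)) hM2β
      have hγ0 : 0 < recordGamma L (recordProfile L) β := recordGamma_record_pos (L := L) hβ0.le
      have hB : B₀ ≤ (L : ℝ) ^ 3 * β := by nlinarith
      have hCEβ := hCE ((L : ℝ) ^ 3 * β) hB
      have hbtCβ := btC_floor_of_quasimode_eta (L := L) hβ0 hfloorβ
      have hx0 : 0 < powScale (1 / 2) β := powScale_pos _ _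
      have hℓ0 : 0 ≤ btLog β := le_trans zero_le_one (one_le_btLog β)
      have hR₀ : 0 ≤ (min (1 / 40) (powScale (1 / 2) β * btLog β)) / 12 := div_nonneg (le_min (by norm_num) (mul_nonneg hx0.le hℓ0)) (by norm_num)
      have hτ0 : 0 ≤ (powScale 1 β) * btLog β := mul_nonneg (powScale_pos _ _).le hℓ0
      have hKsep : 0 ≤ Real.exp (2 * β) ^ Fintype.card (Edge 3 L) * Real.exp (-(β * ((min (1 / 40) (powScale (1 / 2) β * btLog β)) / 1000) ^ 2)) := by positivity
      have hδw := record_window_le_DO (L := L) hD0 β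
      -- now the fixed-`β` assembly (lane A `hdef_fixed`, ported)
      obtain ⟨Cφ, hCφ⟩ := hφb
      haveI := isFiniteMeasure_orthoTransverse L
      obtain ⟨hχm, hχ1, hχ0, -⟩ := recordChi_props (L := L) (1 / 6) ((42 * max 1 ((Fintype.card (Site 3 L) : ℝ) / 7) + 1)) M β
      obtain ⟨hwm, hwb, hw0, -⟩ := softWeight_recordChi_props (L := L) (1 / 6) ((42 * max 1 ((Fintype.card (Site 3 L) : ℝ) / 7) + 1)) M β
      have hqfm : ∀ β', Measurable ((fun β' => stiffGaussExp L (β' / 2) β') β') := fun β' => measurable_stiffGaussExp _ _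
      have hqf0 : ∀ β' x, 0 ≤ (fun β' => stiffGaussExp L (β' / 2) β') β' x := fun β' x => stiffGaussExp_nonneg _ _ x
      have hΩGm : Measurable (frozenProfile L (fun β' => stiffGaussExp L (β' / 2) β') (fun β' => min (1 / 40) (powScale (1 / 2) β' * btLog β')) β) := measurable_frozenProfile hqfm _ β
      have hΩG0 : ∀ x, 0 ≤ frozenProfile L (fun β' => stiffGaussExp L (β' / 2) β') (fun β' => min (1 / 40) (powScale (1 / 2) β' * btLog β')) β x := fun x => (frozenProfile_mem_Icc hqf0 _ β x).1
      have hΩG1 : ∀ x, |frozenProfile L (fun β' => stiffGaussExp L (β' / 2) β') (fun β' => min (1 / 40) (powScale (1 / 2) β' * btLog β')) β x| ≤ 1 := abs_frozenProfile_le hqf0 _ β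
      have hΩm : Measurable (fun x : LinkSpace L => {x : LinkSpace L | linkCurry x ∈ capBalancedSet L}.indicator (fun _ => (1 : ℝ)) x * frozenProfile L (fun β' => stiffGaussExp L (β' / 2) β') (fun β' => min (1 / 40) (powScale (1 / 2) β' * btLog β')) β x) := measurable_capRestrict (L := L) hΩGm
      have hΩ1 : ∀ x, |(fun x : LinkSpace L => {x : LinkSpace L | linkCurry x ∈ capBalancedSet L}.indicator (fun _ => (1 : ℝ)) x * frozenProfile L (fun β' => stiffGaussExp L (β' / 2) β') (fun β' => min (1 / 40) (powScale (1 / 2) β' * btLog β')) β x) x| ≤ 1 := fun x => (capRestrict_mem (L := L) hΩG0 hΩG1 x).2.2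
      have hZi : 0 < (fpZ (powScale 1 β))⁻¹ := inv_pos.2 (fpZ_pos (powScale_pos 1 β))
      have hK1 : 0 < transferKernel su2Rep ((L : ℝ) ^ 3 * β) (1 : GaugeConfig 3 1 SU2) 1 := transferKernel_pos _ _ _ _
      obtain ⟨hSlo, -⟩ := stiffGaussTop_record_bounds (L := L) hβ0
      have hS : 0 < stiffGaussTop L (β / 2) β := lt_of_lt_of_le (pow_pos (Real.sqrt_pos.2 (by positivity)) _) hSlo
      have hI0 : 0 < (∫ u, ({u : GaugeConfig 3 1 SU2 | (∀ k : Fin 3, ‖su2Quat (u (0, k)) - 1‖ ≤ (powScale (1 / 3) β)) ∧ (L : ℝ) ^ 3 * wilsonAction su2Rep u ≤ (powScale (1 / 2) β)}.indicator (fun _ => (1 : ℝ))) u * (transferKernel su2Rep ((L : ℝ) ^ 3 * β) (1 : GaugeConfig 3 1 SU2) u / transferKernel su2Rep ((L : ℝ) ^ 3 * β) (1 : GaugeConfig 3 1 SU2) 1) ∂configMeasure SU2 1) := slowWindow_I0_pos (L := L) (powScale_pos (1 / 3) β) (powScale_pos (1 / 2) β) ((L : ℝ) ^ 3 * β)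
      have ha₀ : 0 ≤ (c₁ β * (stiffGaussTop L (β / 2) β / (∫ u, ({u : GaugeConfig 3 1 SU2 | (∀ k : Fin 3, ‖su2Quat (u (0, k)) - 1‖ ≤ (powScale (1 / 3) β)) ∧ (L : ℝ) ^ 3 * wilsonAction su2Rep u ≤ (powScale (1 / 2) β)}.indicator (fun _ => (1 : ℝ))) u * (transferKernel su2Rep ((L : ℝ) ^ 3 * β) (1 : GaugeConfig 3 1 SU2) u / transferKernel su2Rep ((L : ℝ) ^ 3 * β) (1 : GaugeConfig 3 1 SU2) 1) ∂configMeasure SU2 1))) := by positivity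
      have hφ2 : 0 ≤ ∫ u, φ u ^ 2 ∂configMeasure SU2 1 := integral_nonneg fun u => sq_nonneg _
      have hcg0 : 0 ≤ (1 / (fpWeightBar L (powScale 1 β) * (1 - Cw * ((42 * max 1 ((Fintype.card (Site 3 L) : ℝ) / 7) + 1) * powScale (1 / 6) β) ^ 2))) := by positivity
      have hPm0 : 0 ≤ (orthoTransverse L Set.univ).toReal := ENNReal.toReal_nonneg
      have hCE0 : 0 ≤ linkCE ((L : ℝ) ^ 3 * β) := (linkCE_pos (by positivity)).le
      -- the dual BO function `ψ`
      set ψ : GaugeConfig 3 1 SU2 → ℝ := (fun u' => (fpZ (powScale 1 β))⁻¹ * (c₁ β * (stiffGaussTop L (β / 2) β / (∫ u, ({u : GaugeConfig 3 1 SU2 | (∀ k : Fin 3, ‖su2Quat (u (0, k)) - 1‖ ≤ (powScale (1 / 3) β)) ∧ (L : ℝ) ^ 3 * wilsonAction su2Rep u ≤ (powScale (1 / 2) β)}.indicator (fun _ => (1 : ℝ))) u * (transferKernel su2Rep ((L : ℝ) ^ 3 * β) (1 : GaugeConfig 3 1 SU2) u / transferKernel su2Rep ((L : ℝ) ^ 3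 * β) (1 : GaugeConfig 3 1 SU2) 1) ∂configMeasure SU2 1))) / fpWeightBar L (powScale 1 β) * (∫ w, φ w * (avgKernel ((L : ℝ) ^ 3 * β) u' w / transferKernel su2Rep ((L : ℝ) ^ 3 * β) (1 : GaugeConfig 3 1 SU2) 1) ∂configMeasure SU2 1)) with hψdef
      have hPm := measurable_slowP ((L : ℝ) ^ 3 * β) (transferKernel su2Rep ((L : ℝ) ^ 3 * β) (1 : GaugeConfig 3 1 SU2) 1) hφm
      have hψm : Measurable ψ := by rw [hψdef]; exact hPm.const_mul _
      obtain ⟨M1, -, hM1⟩ := exists_avgKernel_le (L := 1) ((L : ℝ) ^ 3 * β)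
      have hPb : ∀ u', |∫ w, φ w * (avgKernel ((L : ℝ) ^ 3 * β) u' w / transferKernel su2Rep ((L : ℝ) ^ 3 * β) (1 : GaugeConfig 3 1 SU2) 1) ∂configMeasure SU2 1| ≤ Cφ * (M1 / transferKernel su2Rep ((L : ℝ) ^ 3 * β) (1 : GaugeConfig 3 1 SU2) 1) :=
        fun u' => abs_slowP_le hK1 hCφ (fun u'' u => hM1 u'' u) u'
      have hCψ : ∀ u', |ψ u'| ≤ (fpZ (powScale 1 β))⁻¹ * (c₁ β * (stiffGaussTop L (β / 2) β / (∫ u, ({u : GaugeConfig 3 1 SU2 | (∀ k : Fin 3, ‖su2Quat (u (0, k)) - 1‖ ≤ (powScale (1 / 3) β)) ∧ (L : ℝ) ^ 3 * wilsonAction su2Rep u ≤ (powScale (1 / 2) β)}.indicator (fun _ => (1 : ℝ))) u * (transferKernel su2Rep ((L : ℝ) ^ 3 * β) (1 : GaugeConfig 3 1 SU2) u / transferKernel su2Rep ((L : ℝ) ^ 3 * β) (1 : GaugeConfig 3 1 SU2) 1) ∂configMeasure SU2 1))) / fpWeightBar L (powScale 1 β) * (Cφ * (M1 / transferKernel su2Rep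 ((L : ℝ) ^ 3 * β) (1 : GaugeConfig 3 1 SU2) 1)) := fun u' => by
        rw [hψdef]; dsimp only
        rw [abs_mul, abs_of_nonneg (by positivity : (0:ℝ) ≤ (fpZ (powScale 1 β))⁻¹ * (c₁ β * (stiffGaussTop L (β / 2) β / (∫ u, ({u : GaugeConfig 3 1 SU2 | (∀ k : Fin 3, ‖su2Quat (u (0, k)) - 1‖ ≤ (powScale (1 / 3) β)) ∧ (L : ℝ) ^ 3 * wilsonAction su2Rep u ≤ (powScale (1 / 2) β)}.indicator (fun _ => (1 : ℝ))) u * (transferKernel su2Rep ((L : ℝ) ^ 3 * β) (1 : GaugeConfig 3 1 SU2) u / transferKernel su2Rep ((L : ℝ) ^ 3 * β) (1 : GaugeConfig 3 1 SU2) 1) ∂configMeasure SU2 1))) / fpWeightBar L (powScale 1 β))]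
        exact mul_le_mul_of_nonneg_left (hPb u') (by positivity)
      -- `F` and `E`
      have hbom := measurable_boFun L hφm hΩm
      have hbob : ∀ V, |boFun L φ (fun x : LinkSpace L => {x : LinkSpace L | linkCurry x ∈ capBalancedSet L}.indicator (fun _ => (1 : ℝ)) x * frozenProfile L (fun β' => stiffGaussExp L (β' / 2) β') (fun β' => min (1 / 40) (powScale (1 / 2) β' * btLog β')) β x) V| ≤ Cφ * 1 := fun V => abs_boFun_le L hCφ hΩ1 V
      obtain ⟨hFm, ⟨CF, hCF⟩, -⟩ := integral_avgKernel_mul_props (L := L) β hbom hbob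
      have hSm : MeasurableSet {U : GaugeConfig 3 L SU2 | (recordChi L (1 / 6) (42 * max 1 ((Fintype.card (Site 3 L) : ℝ) / 7) + 1) M β) U ≠ 0} := (hχm (measurableSet_singleton 0)).compl
      obtain ⟨hEm, hEb, hEid⟩ := defect_of_weight_lower_bound (L := L) hΩm hΩ1 hwm hSm hNκ (fun U hU => hwS U hU) (v := (recordChi L (1 / 6) (42 * max 1 ((Fintype.card (Site 3 L) : ℝ) / 7) + 1) M β)) (fun U hU => hU) hψm hCψ hFm hCF
      refine ⟨ψ, _, hψm, ⟨_, hCψ⟩, hEm, ⟨_, hEb⟩, hEid, ?_⟩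
      -- the split
      have hsupp : ∀ U, (recordChi L (1 / 6) (42 * max 1 ((Fintype.card (Site 3 L) : ℝ) / 7) + 1) M β) U ≠ 0 → U ∈ orthoTubeSet L ∧ orbitDist (slowMean L U) ≤ ((12 * (42 * max 1 ((Fintype.card (Site 3 L) : ℝ) / 7) + 1) + 1) / (Fintype.card (Site 3 L) : ℝ)) * powScale (1 / 6) β :=
        fun U hU => ⟨(hsuppβ U hU).2.2.1, (hsuppβ U hU).2.2.2.2.2⟩
      have hsplit := record_defect_split_K (L := L) β (s := 1 / 6) (Kc := (42 * max 1 ((Fintype.card (Site 3 L) : ℝ) / 7) + 1)) (M := M) (D := ((12 * (42 * max 1 ((Fintype.card (Site 3 L) : ℝ) / 7) + 1) + 1) / (Fintype.card (Site 3 L) : ℝ))) hφm hCφ hψm hCψ hNκ hwS hsupp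
      -- piece 1: the core, in currency, with the potential
      have h1 := hco φ hφm Cφ hCφ hφs
      -- piece 2: the FP tail against the `Z⁻²`-floor
      have hFl' : 0 < cR' * powScale 1 β ^ K' * (Real.exp (2 * β) ^ Fintype.card (Edge 3 L)) ^ 2 := mul_pos (mul_pos hcR' (pow_pos (powScale_pos 1 β) _)) (by positivity)
      have h2 := piece_rate_pot_of_factor hFl' hcg0 (hfliβ φ hφm Cφ hCφ hφs)
        (tail_sq_integral_le_K (L := L) hβ0.le hNκ hPlo (le_refl _) hLa hm₁ hm₂ hP3 hP0 hJ hφm hCφ (slow_window_of_orbitDist hδw hφs))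
      -- piece 3: the outer region against the plain floor
      have hFl : 0 < cR * powScale 1 β ^ K * (Real.exp (2 * β) ^ Fintype.card (Edge 3 L)) ^ 2 := mul_pos (mul_pos hcR (pow_pos (powScale_pos 1 β) _)) (by positivity)
      have hY : 0 ≤ (orthoTransverse L Set.univ).toReal * (1 / (fpWeightBar L (powScale 1 β) * (1 - Cw * ((42 * max 1 ((Fintype.card (Site 3 L) : ℝ) / 7) + 1) * powScale (1 / 6) β) ^ 2))) * ((Real.exp (2 * β) ^ Fintype.card (Edge 3 L)) ^ 2 * (Real.exp (-(β * (2 - 2 * Real.cos (2 * Real.pi / L)) * ((min (1 / 40) (powScale (1 / 2) β * btLog β)) / 12 / 2) ^ 2)) + Real.exp (-(((powScale 1 β) * btLog β) ^ 2 / powScale 1 β ^ 2)) ^ 2 + Real.exp (-(((powScale 1 β) * btLog β) ^ 2 / powScale 1 β ^ 2))) + Real.exp (2 * β) ^ Fintype.card (Edge 3 L) * (Real.exp (2 * β) ^ Fintype.card (Edge 3 L) * Real.exp (-(β * ((min (1 / 40) (powScale (1 / 2) β * btLog β)) / 1000) ^ 2)))) := by positivity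
      have h3 := piece_rate_pot' hFl (by norm_num : (0:ℝ) ≤ 3) hY (hflβ φ hφm Cφ hCφ hφs)
        (out_sq_integral_le_of_sep_K (L := L) hL2 hβ1 hβg hNκ hPlo hφm hCφ (slow_window_of_orbitDist (le_refl _) hφs) hR₀ hτ0 hKsep hsepβ)
      -- piece 4: the shell in relative currency
      have hsh := shell_dualBO_sq_integral_le_K (L := L) hL2 hβ1 hβg hPhi hNhi hφm hCφ (c₁ β * (stiffGaussTop L (β / 2) β / (∫ u, ({u : GaugeConfig 3 1 SU2 | (∀ k : Fin 3, ‖su2Quat (u (0, k)) - 1‖ ≤ (powScale (1 / 3) β)) ∧ (L : ℝ) ^ 3 * wilsonAction su2Rep u ≤ (powScale (1 / 2) β)}.indicator (fun _ => (1 : ℝ))) u * (transferKernel su2Rep ((L : ℝ) ^ 3 * β) (1 : GaugeConfig 3 1 SU2) u / transferKernel su2Rep ((L : ℝ) ^ 3 * β) (1 : GaugeConfig 3 1 SU2) 1) ∂configMeasure SU2 1))) hR₀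
      have h4 := shell_piece_pot (p := powScale (1 / 5) β) (x := (42 * max 1 ((Fintype.card (Site 3 L) : ℝ) / 7) + 1) * powScale (1 / 6) β) hZi hc₁ hS hI0 hNhi (Real.exp_pos _).le hPm0 hNb hM2 hK1 hφ2 hηβ hγ0 hCE0
        (powScale_pos _ _).le hp1 hsh hbtCβ (hnormβ φ hφm Cφ hCφ hφs) hγ2β hCEβ (sigma_forms_eq _ _ _ _)
      -- assemble
      exact defect_bound_of_pieces_pot (tubeNormSq_nonneg' hw0 _) (orbit_moment_window_eq hφs) hsplit h1 h2 h3 h4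
    have hOD := hODpotA_of_defect (L := L) (Ω := fun β => recordProfile L β) (χ := fun β => (recordChi L (1 / 6) (42 * max 1 ((Fintype.card (Site 3 L) : ℝ) / 7) + 1) M β)) (δ₁ := fun β => max 1 ((Fintype.card (Site 3 L) : ℝ) / 7) * recordDelta1 L (1 / 6) β)
      (Λ := fun β => (btC L β (recordProfile L β) (btEps β) (5 * (powScale (1 / 2) β * btLog β ^ 2)) / fpZ (btEps β) / recordGamma L (recordProfile L) β * levelValue su2Rep 1 ((L : ℝ) ^ 3 * β) 0)) (b := fun β => Real.sqrt (2 * (Cb * (η β ^ 2 + powScale (2 / 3) β) + ((Real.exp (β * (2 * (Fintype.card (Edge 3 L) : ℝ))) * (Real.exp (-(β * btMnt L (((12 * (42 * max 1 ((Fintype.card (Site 3 L) : ℝ) / 7) + 1) + 1) / (Fintype.card (Site 3 L) : ℝ)) * powScale (1 / 6) β) (powScale (1 / 2) β * btLog β ^ 2) (min (1 / 40) (powScale (1 / 2) β * btLog β)) (5 * (powScale (1 / 2) β * btLog β ^ 2)) (powScale 1 β))) + Real.exp (-(β * btMfar L (((12 * (42 * max 1 ((Fintype.card (Site 3 L) :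 ℝ) / 7) + 1) + 1) / (Fintype.card (Site 3 L) : ℝ)) * powScale (1 / 6) β) (powScale (1 / 2) β * btLog β ^ 2) (min (1 / 40) (powScale (1 / 2) β * btLog β)) (powScale 1 β) (13 * (((12 * (42 * max 1 ((Fintype.card (Site 3 L) : ℝ) / 7) + 1) + 1) / (Fintype.card (Site 3 L) : ℝ)) * powScale (1 / 6) β))))) * ∫ v, (fun x : LinkSpace L => {x : LinkSpace L | linkCurry x ∈ capBalancedSet L}.indicator (fun _ => (1 : ℝ)) x * frozenProfile L (fun β' => stiffGaussExp L (β' / 2) β') (fun β' => min (1 / 40) (powScale (1 / 2) β' * btLog β')) β x) (linkEmbed L v) ∂orthoTransverse L) ^ 2 * (1 / (fpWeightBar L (powScale 1 β) * (1 - Cw * ((42 * max 1 ((Fintype.card (Site 3 L) : ℝ) / 7) + 1) * powScale (1 / 6) β) ^ 2)))) / (cR' * powScale 1 β ^ K' * (Real.exp (2 * β) ^ Fintype.card (Edge 3 L)) ^ 2) + (3 * ((orthoTransverse L Set.univ).toReal * (1 / (fpWeightBar L (powScale 1 β) * (1 - Cw * ((42 * max 1 ((Fintype.card (Site 3 L)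 : ℝ) / 7) + 1) * powScale (1 / 6) β) ^ 2))) * ((Real.exp (2 * β) ^ Fintype.card (Edge 3 L)) ^ 2 * (Real.exp (-(β * (2 - 2 * Real.cos (2 * Real.pi / L)) * ((min (1 / 40) (powScale (1 / 2) β * btLog β)) / 12 / 2) ^ 2)) + Real.exp (-(((powScale 1 β) * btLog β) ^ 2 / powScale 1 β ^ 2)) ^ 2 + Real.exp (-(((powScale 1 β) * btLog β) ^ 2 / powScale 1 β ^ 2))) + Real.exp (2 * β) ^ Fintype.card (Edge 3 L) * (Real.exp (2 * β) ^ Fintype.card (Edge 3 L) * Real.exp (-(β * ((min (1 / 40) (powScale (1 / 2) β * btLog β)) / 1000) ^ 2)))))) / (cR * powScale 1 β ^ K * (Real.exp (2 * β) ^ Fintype.card (Edge 3 L)) ^ 2) + 8 * (8 * (fpWeightBar L (powScale 1 β) * (1 + Cw * ((42 * max 1 ((Fintype.card (Site 3 L) : ℝ) / 7) + 1) * powScale (1 / 6) β) ^ 2)) * (Real.exp (-(β * (2 - 2 * Real.cos (2 * Real.pi / L)) * ((min (1 / 40) (powScale (1 / 2) β * btLog β)) / 12) ^ 2)) * (orthoTransverse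 L Set.univ).toReal) / ((1 - powScale (1 / 5) β) ^ 2 * (1 - 0 * ((42 * max 1 ((Fintype.card (Site 3 L) : ℝ) / 7) + 1) * powScale (1 / 6) β) ^ 2) * (∫ v, {v : Edge 3 L → Fin 3 → ℝ | ‖linkEmbed L v‖ ≤ (min (1 / 40) (powScale (1 / 2) β * btLog β)) / 12}.indicator (fun _ => (1 : ℝ)) v * (Real.exp (-(stiffGaussExp L (β / 2) β (linkEmbed L v))) ^ 2 * Real.exp (-(‖(gaugeModes L).starProjection (linkEmbed L v)‖ ^ 2 / powScale 1 β ^ 2))) ∂orthoTransverse L) * fpWeightBar L (powScale 1 β)))))) (P := fun β φ => 2 * κA * recordGamma L (recordProfile L) β * ∫ u, (if orbitDist u < max 1 ((Fintype.card (Site 3 L) : ℝ) / 7) * recordDelta1 L (1 / 6) β then orbitDist u ^ 2 else 0) * φ u ^ 2 ∂configMeasure SU2 1) hΩm' hΩ1' hw hΛ hdef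
    exact hOD

end Summit.QuantumFields.YangMills.Theorems.FemtoTransferGap.TwoLattice.ConstTube

end
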